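import Summits.BirchSwinnertonDyer.BirchSwinnertonDyer.Theorems.SylvesterTwoHeegnerIndexCMNormForm
import HarnessLib

/-!
# Route `SylvesterTwoHeegnerIndex` (rung K7t), item 19580 `TwoAdicPairHSY`:
# `2` is INERT in `ℤ[ω]` — `ord₂ N(a + bω)` is even — and the parity assembly

HONEST FRAMING (cell b2b-bsdres, seat x1b GEN 48 = O12 class lead; `--supports
stmt-BirchSwinnertonDyer-19580`). Sequel of `…CMNormForm.lean` (the CM action `[ω](x,y) = (ωx, y)` and
the norm form `ĥ(a•X + b•[ω]X) = (a² − ab + b²)·ĥ(X)`). Item 19580 (`ord₂(#Ш_an(E_p)·#Ш_an(E_{3p²}))`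
even on 𝒞_HSY) is OPEN and STAYS OPEN here; this file proves, with NO named fact and NO definition:

* `norm_odd_of_not_two_dvd`, `norm_eq_zero_iff`, `even_padicValInt_two_norm`,
  `even_padicValRat_two_norm_div_sq` — `a² − ab + b²` is ODD unless `2 ∣ a ∧ 2 ∣ b` (the residue
  field of `ℤ[ω]` at `2` is `𝔽₄`: `X² + X + 1` has no root mod `2`), hence `ord₂(a² − ab + b²)` and
  `ord₂((a² − ab + b²)/n²)` are EVEN for `(a, b) ≠ (0, 0)`, `n ≠ 0` — the prime `2` is INERT in
  `ℤ[ω] = ℤ[(−1+√−3)/2]`;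
* `canonicalHeight_add_of_isOfFinAddOrder` — `ĥ(X + T) = ĥ(X)` for torsion `T`;
* **`even_padicValRat_two_of_height_identity`** — THE ASSEMBLY the class-wide parity of 19580 runs
  on: over a number field `K ∋ ω`, for any `θ` acting by `[ω](x,y) = (ωx, y)`, if `P` is
  non-torsion, `n•Y = a•P + b•[ω]P + T` (`n ≠ 0`, `T` torsion — i.e. `Y ∈ K·P` inside
  `E(K) ⊗ ℚ`; Hu–Shu–Yin p. 8: `K ⊗_{O_K} E_p(K) ≃ K`) and a rational `q ≠ 0` satisfies
  `q·ĥ(P) = 2^i·ĥ(Y)` with `i` EVEN (Hu–Shu–Yin p. 12 (bsd): `q = #Ш_an(E_p)·#Ш_an(E_{3p²})`,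
  `i ∈ {0, −2}`), then `ord₂ q` is EVEN. No odd-index lemma, no integrality, no Kolyvagin: only
  `2`-inertness.

WHAT THIS IS NOT: not 19580 for any `p` — the identity `q·ĥ(P) = 2^i·ĥ(Y)` with `Y ∈ E_p(K)` and the
`K`-line structure of `E_p(K)` are Hu–Shu–Yin's / Dasgupta–Voight's theorems, taken by the next file
as ONE cited fact; nothing about `Ш`; nothing booked, no label moves.
References: [HuShuYin2019] pp. 8, 11, 12; [SilvermanAEC2009] VIII.9.3.
-/

set_option autoImplicit false
-- the Summit-side namespace `Summit.BirchSwinnertonDyer.BirchSwinnertonDyer.…` (summit = problem) is mandated by D-0017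
set_option linter.dupNamespace false

noncomputable section

open scoped Classical

open WeierstrassCurve WeierstrassCurve.Affine WeierstrassCurve.Affine.Point

namespace Summit.BirchSwinnertonDyer.BirchSwinnertonDyer.Theorems.SylvesterTwoCMNormForm

/-! ## §3 `2` is inert in `ℤ[ω]`: `ord₂(a² − ab + b²)` is even -/

section TwoInert

/-- `a² − ab + b²` is ODD unless `2 ∣ a` and `2 ∣ b` (the residue field of `ℤ[ω]` at `2` is `𝔽₄`:
`X² + X + 1` has no root mod `2`). [folklore] -/
theorem norm_odd_of_not_two_dvd {a b : ℤ} (h : ¬ (2 ∣ a ∧ 2 ∣ b)) :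
    ¬ (2 : ℤ) ∣ a ^ 2 - a * b + b ^ 2 := by
  intro hd
  apply h
  have h2 : (a ^ 2 - a * b + b ^ 2) % 2 = 0 := Int.emod_eq_zero_of_dvd hd
  have e : a ^ 2 - a * b + b ^ 2 = (a * a - a * b + b * b) := by ring
  rcases Int.emod_two_eq_zero_or_one a with ha | ha <;>
    rcases Int.emod_two_eq_zero_or_one b with hb | hb
  · exact ⟨Int.dvd_of_emod_eq_zero ha, Int.dvd_of_emod_eq_zero hb⟩
  all_goals
    exfalso
    have : (a ^ 2 - a * b + b ^ 2) % 2 = 1 := by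
      rw [e, Int.add_emod, Int.sub_emod, Int.mul_emod, Int.mul_emod a b, Int.mul_emod b b, ha, hb]
      decide
    omega

/-- `a² − ab + b² = 0` over `ℤ` only for `a = b = 0` (positive definite). [folklore] -/
theorem norm_eq_zero_iff {a b : ℤ} : a ^ 2 - a * b + b ^ 2 = 0 ↔ a = 0 ∧ b = 0 := by
  constructor
  · intro h
    have h4 : (2 * a - b) ^ 2 + 3 * b ^ 2 = 0 := by linear_combination 4 * h
    have hb : b = 0 := by nlinarith [sq_nonneg (2 * a - b), sq_nonneg b]
    subst hb
    simp only [mul_zero, sub_zero, ne_eq, OfNat.ofNat_ne_zero, not_false_eq_true, zero_pow,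
      add_zero, pow_eq_zero_iff] at h4
    omega
  · rintro ⟨rfl, rfl⟩
    simp

/-- **`ord₂ N(a + bω)` is EVEN**: `padicValInt 2 (a² − ab + b²)` is even for `(a, b) ≠ (0, 0)`
(induction: either the norm is odd, or `2 ∣ a`, `2 ∣ b` and `N(a + bω) = 4·N(a/2 + (b/2)ω)`) —
the prime `2` is inert in `ℤ[ω]`. [folklore] -/
theorem even_padicValInt_two_norm : ∀ (n : ℕ) (a b : ℤ), a.natAbs + b.natAbs ≤ n →
    ¬ (a = 0 ∧ b = 0) → Even (padicValInt 2 (a ^ 2 - a * b + b ^ 2)) := by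
  intro n
  induction n with
  | zero =>
    intro a b hn hab
    exfalso
    apply hab
    omega
  | succ n ih =>
    intro a b hn hab
    by_cases h : 2 ∣ a ∧ 2 ∣ b
    · obtain ⟨⟨a', rfl⟩, ⟨b', rfl⟩⟩ := h
      have hab' : ¬ (a' = 0 ∧ b' = 0) := by
        rintro ⟨rfl, rfl⟩
        exact hab ⟨by ring, by ring⟩
      have hne : a' ^ 2 - a' * b' + b' ^ 2 ≠ 0 := fun h0 => hab' (norm_eq_zero_iff.mp h0)
      have hn' : a'.natAbs + b'.natAbs ≤ n := by
        have : a' ≠ 0 ∨ b' ≠ 0 := by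
          by_contra hc
          simp only [not_or, not_not] at hc
          exact hab' hc
        have e1 : (2 * a').natAbs = 2 * a'.natAbs := by rw [Int.natAbs_mul]; rfl
        have e2 : (2 * b').natAbs = 2 * b'.natAbs := by rw [Int.natAbs_mul]; rfl
        rw [e1, e2] at hn
        rcases this with h' | h'
        · have := Int.natAbs_pos.mpr h'
          omega
        · have := Int.natAbs_pos.mpr h'
          omega
      have e : (2 * a') ^ 2 - 2 * a' * (2 * b') + (2 * b') ^ 2 =
          2 * (2 * (a' ^ 2 - a' * b' + b' ^ 2)) := by ring
      have h22 : padicValInt 2 (2 : ℤ) = 1 := by exact_mod_cast padicValInt.self one_lt_two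
      have hne2 : (2 : ℤ) * (a' ^ 2 - a' * b' + b' ^ 2) ≠ 0 := mul_ne_zero two_ne_zero hne
      rw [e, padicValInt.mul two_ne_zero hne2, padicValInt.mul two_ne_zero hne, h22]
      obtain ⟨k, hk⟩ := ih a' b' hn' hab'
      exact ⟨k + 1, by omega⟩
    · have hodd := norm_odd_of_not_two_dvd h
      rw [padicValInt.eq_zero_of_not_dvd hodd]
      exact ⟨0, rfl⟩

/-- **`ord₂ ((a² − ab + b²)/n²)` is even** for `(a, b) ≠ (0, 0)` and `n ≠ 0` (as `padicValRat`).
[folklore] -/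
theorem even_padicValRat_two_norm_div_sq {a b n : ℤ} (hab : ¬ (a = 0 ∧ b = 0)) (hn : n ≠ 0) :
    Even (padicValRat 2 (((a ^ 2 - a * b + b ^ 2 : ℤ) : ℚ) / ((n : ℚ) ^ 2))) := by
  have hne : ((a ^ 2 - a * b + b ^ 2 : ℤ) : ℚ) ≠ 0 := by
    exact_mod_cast fun h0 => hab (norm_eq_zero_iff.mp h0)
  have hn2 : ((n : ℚ) ^ 2) ≠ 0 := pow_ne_zero 2 (by exact_mod_cast hn)
  rw [padicValRat.div hne hn2, padicValRat.pow, padicValRat.of_int, padicValRat.of_int]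
  obtain ⟨k, hk⟩ := even_padicValInt_two_norm _ a b le_rfl hab
  exact ⟨(k : ℤ) - padicValInt 2 n, by rw [hk]; push_cast; ring⟩

end TwoInert

/-! ## §4 Assembly: the parity of `ord₂ q` from a height identity `q·ĥ(P) = 2^i·ĥ(Y)` -/

section Assembly

variable {K : Type*} [Field K] [NumberField K] {W : WeierstrassCurve K} [W.IsElliptic] {ω : K}
variable (hω : ω ^ 2 + ω + 1 = 0) (h1 : W.a₁ = 0) (h2 : W.a₂ = 0) (h3 : W.a₃ = 0) (h4 : W.a₄ = 0)

/-- The height of a torsion translate: `ĥ(X + T) = ĥ(X)` for `T` torsion (`⟨X, T⟩ = 0` because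
`m•T = 0` gives `m·⟨X, T⟩ = ⟨X, 𝒪⟩ = 0`, and `ĥ(T) = 0`, tree `canonicalHeight_eq_zero_iff_holds`).
[cite: SilvermanAEC2009, Thm. VIII.9.3(d)] -/
theorem canonicalHeight_add_of_isOfFinAddOrder (X T : W.toAffine.Point) (hT : IsOfFinAddOrder T) :
    canonicalHeight (X + T) = canonicalHeight X := by
  obtain ⟨m, hm, hmT⟩ := hT.exists_nsmul_eq_zero
  have hpair : heightPairing X T = 0 := by
    have h := heightPairing_zsmul_right (m : ℤ) X T
    rw [natCast_zsmul, hmT] at h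
    simp only [heightPairing, add_zero, canonicalHeight_zero, sub_self, zero_div] at h
    have hm' : (m : ℝ) ≠ 0 := by exact_mod_cast hm.ne'
    have := mul_eq_zero.mp h.symm
    push_cast at this
    exact this.resolve_left hm'
  rw [canonicalHeight_add, hpair, (canonicalHeight_eq_zero_iff_holds T).mpr hT]
  ring

variable {θ : W.toAffine.Point → W.toAffine.Point} (hθ0 : θ 0 = 0)
  (hθ : ∀ (x y : K) (h : W.toAffine.Nonsingular x y),
    θ (.some x y h) = .some (ω * x) y (nonsingular_omega_mul hω h1 h2 h3 h4 h))

include hω h1 h2 h3 h4 hθ0 hθ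

/-- **ASSEMBLY (the `2`-inertness argument).** Over a number field `K ∋ ω` (`ω² + ω + 1 = 0`), on a
Mordell equation with `θ` acting by `[ω](x, y) = (ωx, y)`: let `P, Y ∈ E(K)` with `P` non-torsion and
`n•Y = a•P + b•[ω]P + T` (`n ≠ 0`, `T` torsion) — i.e. `Y = [(a + bω)/n]P` in `E(K) ⊗ ℚ = K·P` — and
let a rational `q ≠ 0` satisfy `q·ĥ(P) = 2^i·ĥ(Y)` with `i` EVEN. Then `ord₂ q` is EVEN:
`q = 2^i·(a² − ab + b²)/n²` and `ord₂(a² − ab + b²)` is even. No odd-index lemma, no integrality.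
[cite: HuShuYin2019, p. 12 (bsd) and p. 8] -/
theorem even_padicValRat_two_of_height_identity {P Y T : W.toAffine.Point} (hP : ¬IsOfFinAddOrder P)
    (hT : IsOfFinAddOrder T) {n a b : ℤ} (hn : n ≠ 0) (hY : n • Y = a • P + b • θ P + T) {q : ℚ}
    (hq : q ≠ 0) {i : ℤ} (hi : Even i)
    (hid : (q : ℝ) * canonicalHeight P = (2 : ℝ) ^ i * canonicalHeight Y) :
    Even (padicValRat 2 q) := by
  have hP' : canonicalHeight P ≠ 0 := fun h' => hP ((canonicalHeight_eq_zero_iff_holds P).mp h')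
  -- `n² ĥ(Y) = ĥ(nY) = ĥ(aP + b[ω]P + T) = (a² − ab + b²) ĥ(P)`
  have hnY : ((n : ℝ) ^ 2) * canonicalHeight Y =
      ((a : ℝ) ^ 2 - a * b + (b : ℝ) ^ 2) * canonicalHeight P := by
    rw [← canonicalHeight_zsmul_holds, hY, canonicalHeight_add_of_isOfFinAddOrder _ T hT,
      canonicalHeight_zsmul_add_zsmul_omegaRot hω h1 h2 h3 h4 hθ0 hθ]
  have hab : ¬ (a = 0 ∧ b = 0) := by
    rintro ⟨rfl, rfl⟩
    have h0 : ((n : ℝ) ^ 2) * canonicalHeight Y = 0 := by rw [hnY]; simp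
    have hY0 : canonicalHeight Y = 0 :=
      (mul_eq_zero.mp h0).resolve_left (pow_ne_zero 2 (by exact_mod_cast hn))
    have : (q : ℝ) * canonicalHeight P = 0 := by rw [hid, hY0, mul_zero]
    rcases mul_eq_zero.mp this with h' | h'
    · exact hq (by exact_mod_cast h')
    · exact hP' h'
  -- solve for `q` as a rational number
  have hqR : (q : ℝ) = (2 : ℝ) ^ i * (((a : ℝ) ^ 2 - a * b + (b : ℝ) ^ 2) / (n : ℝ) ^ 2) := by
    have hn2 : ((n : ℝ) ^ 2) ≠ 0 := pow_ne_zero 2 (by exact_mod_cast hn)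
    have hY' : canonicalHeight Y =
        ((a : ℝ) ^ 2 - a * b + (b : ℝ) ^ 2) / (n : ℝ) ^ 2 * canonicalHeight P := by
      rw [div_mul_eq_mul_div, eq_div_iff hn2]
      linear_combination hnY
    have : (q : ℝ) * canonicalHeight P =
        (2 : ℝ) ^ i * (((a : ℝ) ^ 2 - a * b + (b : ℝ) ^ 2) / (n : ℝ) ^ 2) * canonicalHeight P := by
      rw [hid, hY']
      ring
    exact mul_right_cancel₀ hP' this
  have hqQ : q = (2 : ℚ) ^ i * ((((a ^ 2 - a * b + b ^ 2 : ℤ) : ℚ)) / ((n : ℚ) ^ 2)) := by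
    have : ((2 : ℚ) ^ i * ((((a ^ 2 - a * b + b ^ 2 : ℤ) : ℚ)) / ((n : ℚ) ^ 2)) : ℝ) =
        (2 : ℝ) ^ i * (((a : ℝ) ^ 2 - a * b + (b : ℝ) ^ 2) / (n : ℝ) ^ 2) := by push_cast; ring
    exact_mod_cast (hqR.trans this.symm)
  have hne : ((((a ^ 2 - a * b + b ^ 2 : ℤ) : ℚ)) / ((n : ℚ) ^ 2)) ≠ 0 := by
    refine div_ne_zero ?_ (pow_ne_zero 2 (by exact_mod_cast hn))
    exact_mod_cast fun h0 => hab (norm_eq_zero_iff.mp h0)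
  have h22 : padicValRat 2 (2 : ℚ) = 1 := by exact_mod_cast padicValRat.self one_lt_two
  rw [hqQ, padicValRat.mul (zpow_ne_zero i two_ne_zero) hne, padicValRat.zpow, h22, mul_one]
  obtain ⟨k, hk⟩ := even_padicValRat_two_norm_div_sq hab hn
  obtain ⟨j, hj⟩ := hi
  exact ⟨j + k, by rw [hk, hj]; ring⟩

end Assembly

end Summit.BirchSwinnertonDyer.BirchSwinnertonDyer.Theorems.SylvesterTwoCMNormForm

end
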